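import Literature.NumberTheory.Rogawski1990.UnitFundamentalLemmaInertLevi
import Literature.NumberTheory.Rogawski1990.UnitFundamentalLemmaInertVanishing
import Literature.NumberTheory.Automorphic.UnitOrbitalIntegralFixedPointsPair
import Literature.NumberTheory.DiophantineGeometry.GenEllValuationMultiplicity
import Literature.NumberTheory.Automorphic.UnitOrbitalIntegralSplitTorusHSide
import Literature.NumberTheory.Rogawski1990.GRegularLocalisation
import HarnessLib

/-!
# [Rogawski1990 §4.9 Prop. 4.9.1 (b)] The unit fundamental lemma at an INERT place on the LEVI classes, per `γ_H` UP TO `H_v`-CONJUGACY, over the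
# `H`-side module binder — the discharge shape of `stub_leviClause` of the line «N7nsCount»
(Rogawski (1990), §4.9 Prop. 4.9.1 (b), (4.9.2) p. 55; §4.3 (4.3.1) p. 43; §4.1 (4.1.1) p. 40; Kottwitz (1986) §7)

Topic `NumberTheory/Rogawski1990`; namespace `Literature.NumberTheory.Rogawski1990`.  THEOREMS ONLY (no definition, no instance, no notation, no named fact, no
`sorry`).  Cell `pub/hodgecm-mathlib`, F0∕P3a, road «D-N7-inert» ∕ MAP v3 «N7-ns COUNT FROM FLICKER» (population (P2) = the Levi classes), line candidate «N7nsCount»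
(A-p06 (g26)) stub `stub_leviClause`; cut-holder F0P3b-p01 (g6).  HC_CM is proved only modulo the 2 remaining named inputs (hLiu418, h413) until rung 0 closes.

THE STATEMENT.  At a non-split place `w ∣ v` of the CM field `L`, unramified, of good reduction for `H′`, `μ` unramified at `w` under the N7 μ-guard, canonical `mG`
with `νG(K′) = 1`: let `γ_H ∈ H_v` be `G`-regular with `𝒪_w`-INTEGRAL characteristic polynomial `χ_{ι_v(γ_H), w}` and `H_v`-conjugate to a Levi element,
`(yγ_Hy⁻¹)₁ = diag(d′₀, d′₁)`.  Then over the single binder `hΦH` — the `H`-side unit orbital integral `Φ(⟦γ_H⟧, 1_{K_H}) = (√‖d′₀⁻¹d′₁ − 1‖)⁻¹` ((4.9.2) on `H`;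
B-p12 (g28) «(L8b)-H») — the clause `Φ^st(γ_H, 1_{K_H}) = ∑ᶠ c, Δ‴_v(γ_H, out c) · Φ(c, 1_{K′})` holds.
PROOF.  §1: `yγ_Hy⁻¹ ∈ K_H` — the eigenvalues `d′₀, u, d′₁` are roots of the monic integral `χ_{ι_v(γ_H), w}` (conjugation invariance, Mathlib
`Matrix.charpoly_units_conj`), hence `w`-integral (★ `GenEll.valuation_le_one_of_isRoot`), and `v_w(d′₀)v_w(d′₁) = 1` (torus relation `σ(d′₀)d′₁ = 1`, ★
`LineRing.torus_relations_two`) makes them units, so `diag(d′) ∈ K₂`; `K₁ = U(Φ₁)(L⁺_v)` at a non-split place (★ `cmLocalIntegralLevel_one_eq_top_of_smul_eq`).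
§2: `G`-regularity and the three Levi units transport to `yγ_Hy⁻¹` (★ `isRegularElt_conj_iff`, ★ `isUnit_levi_of_isLocalGRegular_of_nonsplit`), ★
`stableOrbitalIntegralRel_indicator_eq_finsum_finExplicitDelta_of_levi_of_nonsplit` gives the clause at `yγ_Hy⁻¹` (`⟦yγ_Hy⁻¹⟧ = ⟦γ_H⟧` feeds `hΦH`), and ★
`stableOrbitalIntegralRel_eq_finsum_finExplicitDelta_iff_of_isLocalStablyConjH` carries it back to `γ_H` (both sides are stable class functions, (4.1.1)).

## References
* [Rogawski1990] J. D. Rogawski, *Automorphic Representations of Unitary Groups in Three Variables*, Ann. of Math. Stud. 123 (1990): §4.9 Prop. 4.9.1 (b), (4.9.2)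
  p. 55; §4.3 (4.3.1) p. 43; §4.1 (4.1.1) p. 40.
* [Kottwitz1986] R. E. Kottwitz, *Base change for unit elements of Hecke algebras*, Compositio Math. 60 (1986): §7.
* [LangANT1994] S. Lang, *Algebraic Number Theory*, 2nd ed. (1994), II §5 Prop. 14 (roots of integral monic polynomials are integral).
-/

set_option autoImplicit false

noncomputable section

open MeasureTheory Measure Set NumberField IsDedekindDomain Matrix Polynomial
open Literature.NumberTheory.Automorphic Literature.NumberTheory.Automorphic.UnitaryGroup
open Literature.NumberTheory.GaloisRepresentations
open scoped NNReal Matrix MatrixGroups Valued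

namespace Literature.NumberTheory.Rogawski1990

/-! ## §1 Integral Levi elements lie in `K_H` -/

/-- **An element of `H_v` in Levi form with INTEGRAL characteristic polynomial lies in `K_H = U(Φ₂)(𝒪_v) × U(Φ₁)(𝒪_v)`** (non-split `v`): for
`γ_H = (diag(d′₀, d′₁), u)` the eigenvalues `d′₀, u, d′₁` of `ι_v(γ_H)` are roots of the monic `χ_{ι_v(γ_H), w}`; if its coefficients are `w`-integral so are
the roots (★ `GenEll.valuation_le_one_of_isRoot`), and `v_w(d′₀)·v_w(d′₁) = 1` (torus relation `σ(d′₀)d′₁ = 1`, `v_w ∘ σ_w = v_w`) forces `v_w(d′ᵢ) = 1`, i.e.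
`diag(d′) ∈ GL₂(𝒪_w)`; the `U(Φ₁)`-factor is all of `K₁` at a non-split place (★ `cmLocalIntegralLevel_one_eq_top_of_smul_eq`).
[cite: Rogawski1990, §4.9 p. 55] [cite: LangANT1994, II §5 Prop. 14] -/
theorem mem_prod_cmLocalIntegralLevel_of_levi_of_integral_charpoly (L : Type) [Field L] [NumberField L] [IsCMField L]
    {v : HeightOneSpectrum (𝓞 ↥(maximalRealSubfield L))} (w : PlacesOver L v) (hw : IsCMField.complexConj L • w.1 = w.1)
    {γH : (cmDatum L 2 (Matrix.of fun i j : Fin 2 => if i.val + j.val + 1 = 2 then (1 : L) else 0)).Local v ×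
      (cmDatum L 1 (Matrix.of fun i j : Fin 1 => if i.val + j.val + 1 = 1 then (1 : L) else 0)).Local v}
    {d' : Fin 2 → (UnitaryGroup.LocalRing L v)ˣ} (hd' : glDiagonal 2 (UnitaryGroup.LocalRing L v) d' = (γH.1.val : GL (Fin 2) (UnitaryGroup.LocalRing L v)))
    (hint : ∀ i : ℕ, ((((endoEmbLocal L v γH).val : GL (Fin 3) (UnitaryGroup.LocalRing L v)).val.map
        (Pi.evalRingHom (fun w' : PlacesOver L v => w'.1.adicCompletion L) w)).charpoly.coeff i) ∈ 𝒪[w.1.adicCompletion L]) :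
    γH ∈ (cmLocalIntegralLevel L 2 (Matrix.of fun i j : Fin 2 => if i.val + j.val + 1 = 2 then (1 : L) else 0) v).prod
      (cmLocalIntegralLevel L 1 (Matrix.of fun i j : Fin 1 => if i.val + j.val + 1 = 1 then (1 : L) else 0) v) := by
  have hc := IsCMField.complexConj_ne_one L
  haveI : Algebra.IsQuadraticExtension ↥(maximalRealSubfield L) L := IsCMField.isQuadraticExtension L
  haveI : Subsingleton (PlacesOver L v) := PlacesOver.subsingleton_of_smul_eq (IsCMField.complexConj L) hc w hw
  have hι := endoEmbLocal_eq_glDiagonal_of_fst_eq L v γH hd'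
  -- the characteristic polynomial at `w` is `∏ (X − dᵢ,w)`
  have hP : ((((endoEmbLocal L v γH).val : GL (Fin 3) (UnitaryGroup.LocalRing L v)).val.map
      (Pi.evalRingHom (fun w' : PlacesOver L v => w'.1.adicCompletion L) w)).charpoly) =
        ∏ i : Fin 3, (X - C ((((![d' 0, (isUnit_finGammaTwo L v γH).unit, d' 1] i : (UnitaryGroup.LocalRing L v)ˣ) :
          UnitaryGroup.LocalRing L v) w))) := by
    rw [show ((endoEmbLocal L v γH).val : GL (Fin 3) (UnitaryGroup.LocalRing L v)).val =
        Matrix.diagonal fun k => ((![d' 0, (isUnit_finGammaTwo L v γH).unit, d' 1] k : (UnitaryGroup.LocalRing L v)ˣ) :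
          UnitaryGroup.LocalRing L v) by rw [hι, coe_glDiagonal], Matrix.diagonal_map (map_zero _), Matrix.charpoly_diagonal]
    rfl
  have hmonic : (∏ i : Fin 3, (X - C ((((![d' 0, (isUnit_finGammaTwo L v γH).unit, d' 1] i : (UnitaryGroup.LocalRing L v)ˣ) :
      UnitaryGroup.LocalRing L v) w)))).Monic := monic_prod_of_monic _ _ fun i _ => monic_X_sub_C _
  -- every eigenvalue is `w`-integral
  have hle : ∀ i : Fin 3, Valued.v ((((![d' 0, (isUnit_finGammaTwo L v γH).unit, d' 1] i : (UnitaryGroup.LocalRing L v)ˣ) :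
      UnitaryGroup.LocalRing L v) w)) ≤ 1 := by
    intro i
    refine Literature.NumberTheory.DiophantineGeometry.GenEll.valuation_le_one_of_isRoot Valued.v
      (p := ∏ i : Fin 3, (X - C ((((![d' 0, (isUnit_finGammaTwo L v γH).unit, d' 1] i : (UnitaryGroup.LocalRing L v)ˣ) :
        UnitaryGroup.LocalRing L v) w)))) (fun n => ?_) ?_ ?_
    · have h := hint n
      rw [hP] at h
      exact (Valuation.mem_valuationSubring_iff _ _).1 h
    · rw [hmonic.leadingCoeff, map_one]
    · rw [IsRoot.def, eval_prod]
      exact Finset.prod_eq_zero (Finset.mem_univ i) (by rw [eval_sub, eval_X, eval_C, sub_self])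
  have hle0 : Valued.v ((d' 0 : UnitaryGroup.LocalRing L v) w) ≤ 1 := by simpa using hle 0
  have hle1 : Valued.v ((d' 1 : UnitaryGroup.LocalRing L v) w) ≤ 1 := by simpa using hle 2
  -- the torus relation `σ(d′₀) d′₁ = 1` forces `v(d′₀) v(d′₁) = 1`, hence both are `1`
  have ht : γH.1 ∈ torusU (conjLocal L (IsCMField.complexConj L) v) (cmLocalForm L 2 v) := ⟨d', hd'⟩
  obtain ⟨-, h01⟩ := LineRing.torus_relations_two (conjLocal L (IsCMField.complexConj L) v) (cmLocalForm_eq_over L 2 v) ⟨_, ht⟩ hd'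
  have hprod : Valued.v ((d' 0 : UnitaryGroup.LocalRing L v) w) * Valued.v ((d' 1 : UnitaryGroup.LocalRing L v) w) = 1 := by
    have h := congrArg (fun x : UnitaryGroup.LocalRing L v => Valued.v (x w)) h01
    simpa only [Pi.mul_apply, Pi.one_apply, map_mul, map_one, conjLocal_apply_eq_galAdicCompletionMap L v w hw,
      valued_galAdicCompletionMap] using h
  have hv0 : Valued.v ((d' 0 : UnitaryGroup.LocalRing L v) w) = 1 :=
    le_antisymm hle0 (by
      calc (1 : WithZero (Multiplicative ℤ)) = _ := hprod.symm
        _ ≤ Valued.v ((d' 0 : UnitaryGroup.LocalRing L v) w) * 1 := mul_le_mul' le_rfl hle1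
        _ = _ := mul_one _)
  have hv1 : Valued.v ((d' 1 : UnitaryGroup.LocalRing L v) w) = 1 :=
    le_antisymm hle1 (by
      calc (1 : WithZero (Multiplicative ℤ)) = _ := hprod.symm
        _ ≤ 1 * Valued.v ((d' 1 : UnitaryGroup.LocalRing L v) w) := mul_le_mul' hle0 le_rfl
        _ = _ := one_mul _)
  have hv : ∀ i : Fin 2, Valued.v ((d' i : UnitaryGroup.LocalRing L v) w) = 1 := fun i => by
    fin_cases i
    · exact hv0
    · exact hv1
  have hvi : ∀ i : Fin 2, Valued.v ((((d' i)⁻¹ : (UnitaryGroup.LocalRing L v)ˣ) : UnitaryGroup.LocalRing L v) w) = 1 := fun i => by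
    have h : Valued.v ((d' i : UnitaryGroup.LocalRing L v) w) *
        Valued.v ((((d' i)⁻¹ : (UnitaryGroup.LocalRing L v)ˣ) : UnitaryGroup.LocalRing L v) w) = 1 := by
      rw [← map_mul, ← Pi.mul_apply, Units.mul_inv, Pi.one_apply, map_one]
    rwa [hv i, one_mul] at h
  refine Subgroup.mem_prod.2 ⟨?_, ?_⟩
  · -- `diag(d′) ∈ K₂`
    refine (mem_localIntegralLevel_iff (IsCMField.complexConj L) 2 _ v γH.1).2 fun w' => ?_
    obtain rfl : w' = w := Subsingleton.elim w' w
    refine (Literature.NumberTheory.Automorphic.mem_glInt_iff_forall_v_le_one _).2 ⟨fun i j => ?_, fun i j => ?_⟩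
    · rw [localGLPiEquiv_apply_apply, ← hd', coe_glDiagonal, Matrix.diagonal_apply]
      split_ifs with h
      · exact (hv i).le
      · rw [Pi.zero_apply, map_zero]; exact zero_le
    · rw [← Pi.inv_apply, ← map_inv, localGLPiEquiv_apply_apply, ← hd', ← map_inv, coe_glDiagonal, Matrix.diagonal_apply]
      split_ifs with h
      · rw [Pi.inv_apply]; exact (hvi i).le
      · rw [Pi.zero_apply, map_zero]; exact zero_le
  · -- `K₁ = U(Φ₁)(L⁺_v)`
    rw [cmLocalIntegralLevel_one_eq_top_of_smul_eq L _ w hw (isUnit_placeForm_antidiagOne (E := L) 1 w.1)]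
    exact Subgroup.mem_top _

/-! ## §2 The clause at a `G`-regular integral `γ_H` conjugate INTO the Levi stratum -/

/-- `G`-regularity is a class function on `H_v` (`ι_v` is a homomorphism; ★ `isRegularElt_conj_iff`). [cite: Rogawski1990, §3.1 p. 19; §4.3 p. 42] -/
theorem isLocalGRegular_conj_iff (L : Type) [Field L] [NumberField L] [IsCMField L] {v : HeightOneSpectrum (𝓞 ↥(maximalRealSubfield L))}
    (y γH : ((cmDatum L 2 (Matrix.of fun i j : Fin 2 => if i.val + j.val + 1 = 2 then (1 : L) else 0)).Local v ×
      (cmDatum L 1 (Matrix.of fun i j : Fin 1 => if i.val + j.val + 1 = 1 then (1 : L) else 0)).Local v)) :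
    IsLocalGRegular L v (y * γH * y⁻¹) ↔ IsLocalGRegular L v γH := by
  show IsRegularElt ((endoEmbLocal L v (y * γH * y⁻¹)).val : GL (Fin 3) (UnitaryGroup.LocalRing L v)) ↔
    IsRegularElt ((endoEmbLocal L v γH).val : GL (Fin 3) (UnitaryGroup.LocalRing L v))
  rw [map_mul, map_mul, map_inv]
  exact isRegularElt_conj_iff _ _

/-- The characteristic polynomial of `ι_v(γ_H)` read at `w` is a class function on `H_v` (Mathlib `Matrix.charpoly_units_conj`). [cite: Rogawski1990, §3.1 p. 19] -/
theorem charpoly_map_endoEmbLocal_conj (L : Type) [Field L] [NumberField L] [IsCMField L] {v : HeightOneSpectrum (𝓞 ↥(maximalRealSubfield L))}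
    (w : PlacesOver L v) (y γH : ((cmDatum L 2 (Matrix.of fun i j : Fin 2 => if i.val + j.val + 1 = 2 then (1 : L) else 0)).Local v ×
      (cmDatum L 1 (Matrix.of fun i j : Fin 1 => if i.val + j.val + 1 = 1 then (1 : L) else 0)).Local v)) :
    ((((endoEmbLocal L v (y * γH * y⁻¹)).val : GL (Fin 3) (UnitaryGroup.LocalRing L v)).val.map
        (Pi.evalRingHom (fun w' : PlacesOver L v => w'.1.adicCompletion L) w)).charpoly) =
      (((endoEmbLocal L v γH).val : GL (Fin 3) (UnitaryGroup.LocalRing L v)).val.map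
        (Pi.evalRingHom (fun w' : PlacesOver L v => w'.1.adicCompletion L) w)).charpoly := by
  rw [Matrix.charpoly_map, Matrix.charpoly_map, map_mul, map_mul, map_inv]
  change (((endoEmbLocal L v y).val * (endoEmbLocal L v γH).val * ((endoEmbLocal L v y).val)⁻¹ : GL (Fin 3) (UnitaryGroup.LocalRing L v)).val).charpoly.map _ = _
  rw [Units.val_mul, Units.val_mul, Matrix.coe_units_inv, Matrix.charpoly_units_conj]

open scoped Classical in
/-- **THE UNIT FUNDAMENTAL LEMMA ON THE LEVI CLASSES, PER `γ_H` UP TO `H_v`-CONJUGACY, OVER THE `H`-SIDE MODULE** (the discharge shape of `stub_leviClause`).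
At a non-split place `w ∣ v` (unramified, good reduction for `H′`), `μ` unramified at `w` under the μ-guard, canonical `mG` (`νG(K′) = 1`): for `γ_H ∈ H_v`
`G`-regular with `𝒪_w`-integral `χ_{ι_v(γ_H),w}` (`hint`) and `y ∈ H_v`, `d′` with `(yγ_Hy⁻¹)₁ = diag(d′₀, d′₁)` (`hyd′`), and ANY family `mH` with
`Φ(⟦γ_H⟧, 1_{K_H}) = (√‖d′₀⁻¹d′₁ − 1‖)⁻¹` (`hΦH`; `hb` names the unit `d′₀⁻¹d′₁ − 1`):
**`Φ^st(γ_H, 1_{K_H}) = ∑ᶠ c, Δ‴_v(γ_H, out c) · Φ(c, 1_{K′})`** for `Δ‴ = finExplicitCollection L H′ μ hl hr`.  §1 puts `yγ_Hy⁻¹` in `K_H`; ★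
`stableOrbitalIntegralRel_indicator_eq_finsum_finExplicitDelta_of_levi_of_nonsplit` (with ★ `isUnit_levi_of_isLocalGRegular_of_nonsplit`) gives the clause there; ★
`stableOrbitalIntegralRel_eq_finsum_finExplicitDelta_iff_of_isLocalStablyConjH` moves it to `γ_H`. [cite: Rogawski1990, §4.9 Prop. 4.9.1 (b), (4.9.2) p. 55; §4.3 (4.3.1)
p. 43; §4.1 (4.1.1) p. 40] [cite: Kottwitz1986, §7] -/
theorem stableOrbitalIntegralRel_indicator_eq_finsum_finExplicitDelta_of_levi_conj_of_nonsplit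
    (L : Type) [Field L] [NumberField L] [IsCMField L] (H' : Matrix (Fin 3) (Fin 3) L)
    (hH' : (H'.map (IsCMField.complexConj L))ᵀ = H') (hH'd : IsUnit H'.det)
    {v : HeightOneSpectrum (𝓞 ↥(maximalRealSubfield L))} (w : PlacesOver L v)
    (hw : IsCMField.complexConj L • w.1 = w.1) (hv : Algebra.IsUnramifiedIn (𝓞 L) v.asIdeal)
    (hH'w : IsUnit (placeForm H' w.1)) (hH'i : hH'w.unit ∈ glInt 3 (w.1.adicCompletion L))
    (μ : HeckeCharacter L) (hμ : μ.IsUnramifiedAt w.1)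
    (hμω : ∀ x : ideleGroup ↥(maximalRealSubfield L), μ (AdeleRing.ideleBaseChange ↥(maximalRealSubfield L) L x) = quadraticHeckeCharCM L x)
    [MeasurableSpace ((cmDatum L 3 H').Local v)] [BorelSpace ((cmDatum L 3 H').Local v)]
    [∀ γ : ((cmDatum L 3 H').Local v), MeasurableSpace (((cmDatum L 3 H').Local v) ⧸ Subgroup.centralizer ({γ} : Set ((cmDatum L 3 H').Local v)))]
    [∀ γ : ((cmDatum L 3 H').Local v), BorelSpace (((cmDatum L 3 H').Local v) ⧸ Subgroup.centralizer ({γ} : Set ((cmDatum L 3 H').Local v)))]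
    [∀ a : ((cmDatum L 2 (Matrix.of fun i j : Fin 2 => if i.val + j.val + 1 = 2 then (1 : L) else 0)).Local v ×
      (cmDatum L 1 (Matrix.of fun i j : Fin 1 => if i.val + j.val + 1 = 1 then (1 : L) else 0)).Local v),
      MeasurableSpace (((cmDatum L 2 (Matrix.of fun i j : Fin 2 => if i.val + j.val + 1 = 2 then (1 : L) else 0)).Local v ×
      (cmDatum L 1 (Matrix.of fun i j : Fin 1 => if i.val + j.val + 1 = 1 then (1 : L) else 0)).Local v) ⧸ Subgroup.centralizer ({a} : Set ((cmDatum L 2 (Matrix.of fun i j : Fin 2 => if i.val + j.val + 1 = 2 then (1 : L) else 0)).Local v ×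
      (cmDatum L 1 (Matrix.of fun i j : Fin 1 => if i.val + j.val + 1 = 1 then (1 : L) else 0)).Local v)))]
    (νG : Measure ((cmDatum L 3 H').Local v)) [νG.IsHaarMeasure] [νG.IsMulRightInvariant]
    (hl : ∀ (v : HeightOneSpectrum (𝓞 ↥(maximalRealSubfield L))) (a : ((cmDatum L 2 (Matrix.of fun i j : Fin 2 => if i.val + j.val + 1 = 2 then (1 : L) else 0)).Local v ×
      (cmDatum L 1 (Matrix.of fun i j : Fin 1 => if i.val + j.val + 1 = 1 then (1 : L) else 0)).Local v)) (b : (cmDatum L 3 H').Local v) (x : ((cmDatum L 2 (Matrix.of fun i j : Fin 2 => if i.val + j.val + 1 = 2 then (1 : L) else 0)).Local v ×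
      (cmDatum L 1 (Matrix.of fun i j : Fin 1 => if i.val + j.val + 1 = 1 then (1 : L) else 0)).Local v)),
      finExplicitDelta L v H' (x * a * x⁻¹) μ b = finExplicitDelta L v H' a μ b)
    (hr : ∀ (v : HeightOneSpectrum (𝓞 ↥(maximalRealSubfield L))) (a : ((cmDatum L 2 (Matrix.of fun i j : Fin 2 => if i.val + j.val + 1 = 2 then (1 : L) else 0)).Local v ×
      (cmDatum L 1 (Matrix.of fun i j : Fin 1 => if i.val + j.val + 1 = 1 then (1 : L) else 0)).Local v)) (b y : (cmDatum L 3 H').Local v),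
      finExplicitDelta L v H' a μ (y * b * y⁻¹) = finExplicitDelta L v H' a μ b)
    (mH : OrbitalMeasureFamily ((cmDatum L 2 (Matrix.of fun i j : Fin 2 => if i.val + j.val + 1 = 2 then (1 : L) else 0)).Local v ×
      (cmDatum L 1 (Matrix.of fun i j : Fin 1 => if i.val + j.val + 1 = 1 then (1 : L) else 0)).Local v)) {mG : OrbitalMeasureFamily ((cmDatum L 3 H').Local v)}
    (hmG : mG.IsCanonical (fun γ => IsRegularElt (γ.val : GL (Fin 3) (UnitaryGroup.LocalRing L v))) νG)
    (hνG : νG (cmLocalIntegralLevel L 3 H' v : Set ((cmDatum L 3 H').Local v)) = 1)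
    {γH : ((cmDatum L 2 (Matrix.of fun i j : Fin 2 => if i.val + j.val + 1 = 2 then (1 : L) else 0)).Local v ×
      (cmDatum L 1 (Matrix.of fun i j : Fin 1 => if i.val + j.val + 1 = 1 then (1 : L) else 0)).Local v)} (hreg : IsLocalGRegular L v γH)
    (hint : ∀ i : ℕ, ((((endoEmbLocal L v γH).val : GL (Fin 3) (UnitaryGroup.LocalRing L v)).val.map
        (Pi.evalRingHom (fun w' : PlacesOver L v => w'.1.adicCompletion L) w)).charpoly.coeff i) ∈ 𝒪[w.1.adicCompletion L])
    (y : ((cmDatum L 2 (Matrix.of fun i j : Fin 2 => if i.val + j.val + 1 = 2 then (1 : L) else 0)).Local v ×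
      (cmDatum L 1 (Matrix.of fun i j : Fin 1 => if i.val + j.val + 1 = 1 then (1 : L) else 0)).Local v)) {d' : Fin 2 → (UnitaryGroup.LocalRing L v)ˣ}
    (hyd' : glDiagonal 2 (UnitaryGroup.LocalRing L v) d' = ((y * γH * y⁻¹).1.val : GL (Fin 2) (UnitaryGroup.LocalRing L v)))
    (hb : IsUnit ((((d' 0)⁻¹ * d' 1 : (UnitaryGroup.LocalRing L v)ˣ) : UnitaryGroup.LocalRing L v) - 1))
    (hΦH : classOrbitalIntegral mH ((((cmLocalIntegralLevel L 2 (Matrix.of fun i j : Fin 2 => if i.val + j.val + 1 = 2 then (1 : L) else 0) v).prod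
      (cmLocalIntegralLevel L 1 (Matrix.of fun i j : Fin 1 => if i.val + j.val + 1 = 1 then (1 : L) else 0) v)) : Set ((cmDatum L 2 (Matrix.of fun i j : Fin 2 => if i.val + j.val + 1 = 2 then (1 : L) else 0)).Local v ×
      (cmDatum L 1 (Matrix.of fun i j : Fin 1 => if i.val + j.val + 1 = 1 then (1 : L) else 0)).Local v)).indicator fun _ => (1 : ℂ)) (ConjClasses.mk γH) =
      ((((NNReal.sqrt (unitModulusChar (UnitaryGroup.LocalRing L v) hb.unit))⁻¹ : ℝ≥0) : ℝ) : ℂ)) :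
    stableOrbitalIntegralRel (IsLocalStablyConjH L v) mH ((((cmLocalIntegralLevel L 2 (Matrix.of fun i j : Fin 2 => if i.val + j.val + 1 = 2 then (1 : L) else 0) v).prod
      (cmLocalIntegralLevel L 1 (Matrix.of fun i j : Fin 1 => if i.val + j.val + 1 = 1 then (1 : L) else 0) v)) : Set ((cmDatum L 2 (Matrix.of fun i j : Fin 2 => if i.val + j.val + 1 = 2 then (1 : L) else 0)).Local v ×
      (cmDatum L 1 (Matrix.of fun i j : Fin 1 => if i.val + j.val + 1 = 1 then (1 : L) else 0)).Local v)).indicator fun _ => (1 : ℂ)) γH =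
      ∑ᶠ c : ConjClasses ((cmDatum L 3 H').Local v), (finExplicitCollection L H' μ hl hr v).Δ γH (Quotient.out c) *
        classOrbitalIntegral mG ((cmLocalIntegralLevel L 3 H' v : Set ((cmDatum L 3 H').Local v)).indicator fun _ => (1 : ℂ)) c := by
  -- the Levi representative `γ_H₁ := y γ_H y⁻¹`: stably conjugate, `G`-regular, integral
  have hconj : IsConj γH (y * γH * y⁻¹) := isConj_iff.2 ⟨y, rfl⟩
  have hst : IsLocalStablyConjH L v γH (y * γH * y⁻¹) := (isLocalStablyConjH_of_isConj_and_conj L γH).1 _ hconj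
  have hreg₁ : IsLocalGRegular L v (y * γH * y⁻¹) := (isLocalGRegular_conj_iff L y γH).2 hreg
  have hint₁ : ∀ i : ℕ, ((((endoEmbLocal L v (y * γH * y⁻¹)).val : GL (Fin 3) (UnitaryGroup.LocalRing L v)).val.map
      (Pi.evalRingHom (fun w' : PlacesOver L v => w'.1.adicCompletion L) w)).charpoly.coeff i) ∈ 𝒪[w.1.adicCompletion L] := by
    intro i; rw [charpoly_map_endoEmbLocal_conj L w y γH]; exact hint i
  have hK := mem_prod_cmLocalIntegralLevel_of_levi_of_integral_charpoly L w hw hyd' hint₁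
  obtain ⟨ha, -, h12⟩ := isUnit_levi_of_isLocalGRegular_of_nonsplit L w hw hyd' hreg₁
  -- the `H`-side value at `⟦y γ_H y⁻¹⟧ = ⟦γ_H⟧`
  have hΦH₁ : classOrbitalIntegral mH ((((cmLocalIntegralLevel L 2 (Matrix.of fun i j : Fin 2 => if i.val + j.val + 1 = 2 then (1 : L) else 0) v).prod
      (cmLocalIntegralLevel L 1 (Matrix.of fun i j : Fin 1 => if i.val + j.val + 1 = 1 then (1 : L) else 0) v)) : Set ((cmDatum L 2 (Matrix.of fun i j : Fin 2 => if i.val + j.val + 1 = 2 then (1 : L) else 0)).Local v ×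
      (cmDatum L 1 (Matrix.of fun i j : Fin 1 => if i.val + j.val + 1 = 1 then (1 : L) else 0)).Local v)).indicator fun _ => (1 : ℂ)) (ConjClasses.mk (y * γH * y⁻¹)) =
      ((((NNReal.sqrt (unitModulusChar (UnitaryGroup.LocalRing L v) hb.unit))⁻¹ : ℝ≥0) : ℝ) : ℂ) := by
    rw [← ConjClasses.mk_eq_mk_iff_isConj.2 hconj]; exact hΦH
  -- the clause at `y γ_H y⁻¹`, transported back to `γ_H`
  exact (stableOrbitalIntegralRel_eq_finsum_finExplicitDelta_iff_of_isLocalStablyConjH L H' μ hl hr mH mG _ _ hst).2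
    (stableOrbitalIntegralRel_indicator_eq_finsum_finExplicitDelta_of_levi_of_nonsplit L H' hH' hH'd w hw hv hH'w hH'i μ hμ hμω νG hl hr
      mH hmG hνG hyd' hK hreg₁ ha hb h12 hΦH₁)

/-! ## §3 (ED. 2) The binder-free form: the `H`-side value supplied by ★ `UnitOrbitalIntegralSplitTorusHSide` (B-p12 (g28)) -/

open scoped Classical in
/-- **THE UNIT FUNDAMENTAL LEMMA ON THE LEVI CLASSES, PER `γ_H` UP TO `H_v`-CONJUGACY — BINDER-FREE** (`stub_leviClause` of «N7nsCount» minus its idle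
binders `hP1`, `hμu`; `hH′u ↦ hH′d`).  At a non-split place `w ∣ v` (unramified, good reduction for `H′`), `μ` unramified at `w` under the μ-guard, CANONICAL
families `mH` (at ★ `IsLocalGRegular`) and `mG` (at `IsRegularElt`) with `νH(K_H) = νG(K′) = 1`: for every `G`-regular `γ_H ∈ H_v` with `𝒪_w`-integral
`χ_{ι_v(γ_H),w}` which is `H_v`-conjugate to a Levi element (`(yγ_Hy⁻¹)₁ = diag(d′)`), **`Φ^st(γ_H, 1_{K_H}) = ∑ᶠ c, Δ‴_v(γ_H, out c) · Φ(c, 1_{K′})`**.  The `H`-side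
value `Φ(⟦γ_H⟧, 1_{K_H}) = (√‖d′₀⁻¹d′₁ − 1‖)⁻¹` is ★ `classOrbitalIntegral_indicator_prod_eq_inv_sqrt_of_torus_regular_of_nonsplit` at `yγ_Hy⁻¹ ∈ K_H` (§1),
its `hPH` by ★ `isLocalGRegular_out_mk`, `hreg₂` by ★ `charpoly_endoGL`, `hK₁` by ★ `cmLocalIntegralLevel_one_eq_top_of_smul_eq`; then §2.
[cite: Rogawski1990, §4.9 Prop. 4.9.1 (b), (4.9.2) p. 55; §4.3 (4.3.1) p. 43; §4.1 (4.1.1) p. 40] [cite: Kottwitz1986, §7] -/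
theorem stableOrbitalIntegralRel_indicator_eq_finsum_finExplicitDelta_of_levi_conj_of_nonsplit'
    (L : Type) [Field L] [NumberField L] [IsCMField L] (H' : Matrix (Fin 3) (Fin 3) L)
    (hH' : (H'.map (IsCMField.complexConj L))ᵀ = H') (hH'd : IsUnit H'.det)
    {v : HeightOneSpectrum (𝓞 ↥(maximalRealSubfield L))} (w : PlacesOver L v)
    (hw : IsCMField.complexConj L • w.1 = w.1) (hv : Algebra.IsUnramifiedIn (𝓞 L) v.asIdeal)
    (hH'w : IsUnit (placeForm H' w.1)) (hH'i : hH'w.unit ∈ glInt 3 (w.1.adicCompletion L))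
    (μ : HeckeCharacter L) (hμ : μ.IsUnramifiedAt w.1)
    (hμω : ∀ x : ideleGroup ↥(maximalRealSubfield L), μ (AdeleRing.ideleBaseChange ↥(maximalRealSubfield L) L x) = quadraticHeckeCharCM L x)
    [MeasurableSpace ((cmDatum L 3 H').Local v)] [BorelSpace ((cmDatum L 3 H').Local v)]
    [∀ γ : ((cmDatum L 3 H').Local v), MeasurableSpace (((cmDatum L 3 H').Local v) ⧸ Subgroup.centralizer ({γ} : Set ((cmDatum L 3 H').Local v)))]
    [∀ γ : ((cmDatum L 3 H').Local v), BorelSpace (((cmDatum L 3 H').Local v) ⧸ Subgroup.centralizer ({γ} : Set ((cmDatum L 3 H').Local v)))]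
    [MeasurableSpace ((cmDatum L 2 (Matrix.of fun i j : Fin 2 => if i.val + j.val + 1 = 2 then (1 : L) else 0)).Local v ×
      (cmDatum L 1 (Matrix.of fun i j : Fin 1 => if i.val + j.val + 1 = 1 then (1 : L) else 0)).Local v)] [BorelSpace ((cmDatum L 2 (Matrix.of fun i j : Fin 2 => if i.val + j.val + 1 = 2 then (1 : L) else 0)).Local v ×
      (cmDatum L 1 (Matrix.of fun i j : Fin 1 => if i.val + j.val + 1 = 1 then (1 : L) else 0)).Local v)]
    [∀ a : ((cmDatum L 2 (Matrix.of fun i j : Fin 2 => if i.val + j.val + 1 = 2 then (1 : L) else 0)).Local v ×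
      (cmDatum L 1 (Matrix.of fun i j : Fin 1 => if i.val + j.val + 1 = 1 then (1 : L) else 0)).Local v),
      MeasurableSpace (((cmDatum L 2 (Matrix.of fun i j : Fin 2 => if i.val + j.val + 1 = 2 then (1 : L) else 0)).Local v ×
      (cmDatum L 1 (Matrix.of fun i j : Fin 1 => if i.val + j.val + 1 = 1 then (1 : L) else 0)).Local v) ⧸ Subgroup.centralizer ({a} : Set ((cmDatum L 2 (Matrix.of fun i j : Fin 2 => if i.val + j.val + 1 = 2 then (1 : L) else 0)).Local v ×
      (cmDatum L 1 (Matrix.of fun i j : Fin 1 => if i.val + j.val + 1 = 1 then (1 : L) else 0)).Local v)))]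
    [∀ a : ((cmDatum L 2 (Matrix.of fun i j : Fin 2 => if i.val + j.val + 1 = 2 then (1 : L) else 0)).Local v ×
      (cmDatum L 1 (Matrix.of fun i j : Fin 1 => if i.val + j.val + 1 = 1 then (1 : L) else 0)).Local v),
      BorelSpace (((cmDatum L 2 (Matrix.of fun i j : Fin 2 => if i.val + j.val + 1 = 2 then (1 : L) else 0)).Local v ×
      (cmDatum L 1 (Matrix.of fun i j : Fin 1 => if i.val + j.val + 1 = 1 then (1 : L) else 0)).Local v) ⧸ Subgroup.centralizer ({a} : Set ((cmDatum L 2 (Matrix.of fun i j : Fin 2 => if i.val + j.val + 1 = 2 then (1 : L) else 0)).Local v ×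
      (cmDatum L 1 (Matrix.of fun i j : Fin 1 => if i.val + j.val + 1 = 1 then (1 : L) else 0)).Local v)))]
    (νH : Measure ((cmDatum L 2 (Matrix.of fun i j : Fin 2 => if i.val + j.val + 1 = 2 then (1 : L) else 0)).Local v ×
      (cmDatum L 1 (Matrix.of fun i j : Fin 1 => if i.val + j.val + 1 = 1 then (1 : L) else 0)).Local v)) [νH.IsHaarMeasure] [νH.IsMulRightInvariant]
    (νG : Measure ((cmDatum L 3 H').Local v)) [νG.IsHaarMeasure] [νG.IsMulRightInvariant]
    {mH : OrbitalMeasureFamily ((cmDatum L 2 (Matrix.of fun i j : Fin 2 => if i.val + j.val + 1 = 2 then (1 : L) else 0)).Local v ×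
      (cmDatum L 1 (Matrix.of fun i j : Fin 1 => if i.val + j.val + 1 = 1 then (1 : L) else 0)).Local v)} {mG : OrbitalMeasureFamily ((cmDatum L 3 H').Local v)}
    (hmH : mH.IsCanonical (IsLocalGRegular L v) νH)
    (hmG : mG.IsCanonical (fun γ => IsRegularElt (γ.val : GL (Fin 3) (UnitaryGroup.LocalRing L v))) νG)
    (hνH : νH (((cmLocalIntegralLevel L 2 (Matrix.of fun i j : Fin 2 => if i.val + j.val + 1 = 2 then (1 : L) else 0) v).prod
      (cmLocalIntegralLevel L 1 (Matrix.of fun i j : Fin 1 => if i.val + j.val + 1 = 1 then (1 : L) else 0) v)) : Set ((cmDatum L 2 (Matrix.of fun i j : Fin 2 => if i.val + j.val + 1 = 2 then (1 : L) else 0)).Local v ×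
      (cmDatum L 1 (Matrix.of fun i j : Fin 1 => if i.val + j.val + 1 = 1 then (1 : L) else 0)).Local v)) = 1)
    (hνG : νG (cmLocalIntegralLevel L 3 H' v : Set ((cmDatum L 3 H').Local v)) = 1)
    (hl : ∀ (v : HeightOneSpectrum (𝓞 ↥(maximalRealSubfield L))) (a : ((cmDatum L 2 (Matrix.of fun i j : Fin 2 => if i.val + j.val + 1 = 2 then (1 : L) else 0)).Local v ×
      (cmDatum L 1 (Matrix.of fun i j : Fin 1 => if i.val + j.val + 1 = 1 then (1 : L) else 0)).Local v)) (b : (cmDatum L 3 H').Local v) (x : ((cmDatum L 2 (Matrix.of fun i j : Fin 2 => if i.val + j.val + 1 = 2 then (1 : L) else 0)).Local v ×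
      (cmDatum L 1 (Matrix.of fun i j : Fin 1 => if i.val + j.val + 1 = 1 then (1 : L) else 0)).Local v)),
      finExplicitDelta L v H' (x * a * x⁻¹) μ b = finExplicitDelta L v H' a μ b)
    (hr : ∀ (v : HeightOneSpectrum (𝓞 ↥(maximalRealSubfield L))) (a : ((cmDatum L 2 (Matrix.of fun i j : Fin 2 => if i.val + j.val + 1 = 2 then (1 : L) else 0)).Local v ×
      (cmDatum L 1 (Matrix.of fun i j : Fin 1 => if i.val + j.val + 1 = 1 then (1 : L) else 0)).Local v)) (b y : (cmDatum L 3 H').Local v),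
      finExplicitDelta L v H' a μ (y * b * y⁻¹) = finExplicitDelta L v H' a μ b)
    {γH : ((cmDatum L 2 (Matrix.of fun i j : Fin 2 => if i.val + j.val + 1 = 2 then (1 : L) else 0)).Local v ×
      (cmDatum L 1 (Matrix.of fun i j : Fin 1 => if i.val + j.val + 1 = 1 then (1 : L) else 0)).Local v)} (hreg : IsLocalGRegular L v γH)
    (hint : ∀ i : ℕ, ((((endoEmbLocal L v γH).val : GL (Fin 3) (UnitaryGroup.LocalRing L v)).val.map
        (Pi.evalRingHom (fun w' : PlacesOver L v => w'.1.adicCompletion L) w)).charpoly.coeff i) ∈ 𝒪[w.1.adicCompletion L])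
    (y : ((cmDatum L 2 (Matrix.of fun i j : Fin 2 => if i.val + j.val + 1 = 2 then (1 : L) else 0)).Local v ×
      (cmDatum L 1 (Matrix.of fun i j : Fin 1 => if i.val + j.val + 1 = 1 then (1 : L) else 0)).Local v)) {d' : Fin 2 → (UnitaryGroup.LocalRing L v)ˣ}
    (hyd' : glDiagonal 2 (UnitaryGroup.LocalRing L v) d' = ((y * γH * y⁻¹).1.val : GL (Fin 2) (UnitaryGroup.LocalRing L v))) :
    stableOrbitalIntegralRel (IsLocalStablyConjH L v) mH ((((cmLocalIntegralLevel L 2 (Matrix.of fun i j : Fin 2 => if i.val + j.val + 1 = 2 then (1 : L) else 0) v).prod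
      (cmLocalIntegralLevel L 1 (Matrix.of fun i j : Fin 1 => if i.val + j.val + 1 = 1 then (1 : L) else 0) v)) : Set ((cmDatum L 2 (Matrix.of fun i j : Fin 2 => if i.val + j.val + 1 = 2 then (1 : L) else 0)).Local v ×
      (cmDatum L 1 (Matrix.of fun i j : Fin 1 => if i.val + j.val + 1 = 1 then (1 : L) else 0)).Local v)).indicator fun _ => (1 : ℂ)) γH =
      ∑ᶠ c : ConjClasses ((cmDatum L 3 H').Local v), (finExplicitCollection L H' μ hl hr v).Δ γH (Quotient.out c) *
        classOrbitalIntegral mG ((cmLocalIntegralLevel L 3 H' v : Set ((cmDatum L 3 H').Local v)).indicator fun _ => (1 : ℂ)) c := by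
  have hconj : IsConj γH (y * γH * y⁻¹) := isConj_iff.2 ⟨y, rfl⟩
  have hreg₁ : IsLocalGRegular L v (y * γH * y⁻¹) := (isLocalGRegular_conj_iff L y γH).2 hreg
  obtain ⟨-, hb, -⟩ := isUnit_levi_of_isLocalGRegular_of_nonsplit L w hw hyd' hreg₁
  have hK := mem_prod_cmLocalIntegralLevel_of_levi_of_integral_charpoly L w hw hyd' fun i => by
    rw [charpoly_map_endoEmbLocal_conj L w y γH]; exact hint i
  -- regularity of the `U(Φ₂)`-component of `y γ_H y⁻¹`
  have h3 : IsRegularElt ((endoEmbLocal L v (y * γH * y⁻¹)).val : GL (Fin 3) (UnitaryGroup.LocalRing L v)) := hreg₁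
  rw [isRegularElt_iff, coe_endoEmbLocal, charpoly_endoGL] at h3
  have hreg₂ : IsRegularElt ((y * γH * y⁻¹).1.val : GL (Fin 2) (UnitaryGroup.LocalRing L v)) := h3.of_mul_left
  have hK₁ : ∀ x : (cmDatum L 1 (Matrix.of fun i j : Fin 1 => if i.val + j.val + 1 = 1 then (1 : L) else 0)).Local v,
      x ∈ cmLocalIntegralLevel L 1 (Matrix.of fun i j : Fin 1 => if i.val + j.val + 1 = 1 then (1 : L) else 0) v := fun x => by
    rw [cmLocalIntegralLevel_one_eq_top_of_smul_eq L _ w hw (isUnit_placeForm_antidiagOne (E := L) 1 w.1)]; exact Subgroup.mem_top x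
  -- the `H`-side value at `⟦y γ_H y⁻¹⟧ = ⟦γ_H⟧` (B-p12 (g28))
  have hΦH := classOrbitalIntegral_indicator_prod_eq_inv_sqrt_of_torus_regular_of_nonsplit L w hw νH hmH hνH hK
    (isLocalGRegular_out_mk hreg₁) hreg₂ hyd' hb hK₁
  rw [← ConjClasses.mk_eq_mk_iff_isConj.2 hconj] at hΦH
  exact stableOrbitalIntegralRel_indicator_eq_finsum_finExplicitDelta_of_levi_conj_of_nonsplit L H' hH' hH'd w hw hv hH'w hH'i μ hμ hμω νG hl hr
    mH hmG hνG hreg hint y hyd' hb hΦH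

end Literature.NumberTheory.Rogawski1990

end
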